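import Summits.BirchSwinnertonDyer.BirchSwinnertonDyer.Theorems.PrintCf2SplitBadTwoCMScalarAtVPoints
import Summits.BirchSwinnertonDyer.BirchSwinnertonDyer.Theorems.PrintCf2SplitBadTwoCMPrimaryDyadicTableRelaxed
import Summits.BirchSwinnertonDyer.BirchSwinnertonDyer.Theorems.PrintCf2SplitBadTwoCMPrimaryPinningSwap
import Summits.BirchSwinnertonDyer.BirchSwinnertonDyer.Theorems.PrintCf2SplitBadTwoRestrictedSelmerEigenProjector
import Literature.NumberTheory.EllipticCurves.GaloisActionProofs
import Mathlib.Data.Nat.Factorization.Basic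
import Mathlib.Tactic.Module
import HarnessLib

/-!
# Crux `PrintCf2.SplitBadTwoRankOneOfFacts` (stmt-BirchSwinnertonDyer-20368), road α v10.3, S3c residual (F3), plain road, leaf (PI), file 1/2:
# THE ALGEBRA OF THE `𝒪_K`-COMBINATION AT `v`, NO `K`-RATIONAL POINT OF ORDER `4`, AND `E(K)[2] ≅ E(K_v)[2]` (ORDER `4`) ON EVERY S3c FRAME

Cell `bsd-print-cf2`, EXTRA WIDTH seat `bsd-line-cf2-p1-w6` g4 (prover-bsd-line-cf2-p1-w6-g4-0); LEAD cf2-p1 g13 ASSIGN 2026-08-28T23:58:11Z;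
`--supports stmt-BirchSwinnertonDyer-20368` (helper, Theses-free). HONEST FRAMING: nothing here closes the crux or a registered stub; BSD is
not proved by any of this; no summit statement is proved by this seat. No definition, no named fact, no `sorry`, no kit. beyond-print theorem: no.

WHAT. The plain road to the last displayed hypothesis `hcounts` of S3c (-w8 g3, `SelmerLocImage.hcounts_of_pointIndex_of_pinning_of_finiteSha`:
`hcounts ⟸ (PI) ∧ (PIN) ∧ (ShaFin)`) needs the POINT INDEX (PI) `v₂ [E(K_v) : im E(K) + 2^N E(K_v)] = ℓ`. -w2 g11 proved its core
(`LocalLineCount.index_zmultiples_baseChange_sup_sup_range_eq`, p680004: `[E(K_v) : ℤ·P_v + C_t + 2^N E(K_v)] = 2^{ℓ}` for every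
2-power-torsion `C_t` with `#C_t = 4`). File 2 (`…LocalPointImageAtV`) supplies the `𝒪_K`-combination
`im(E(K) → E(K_v)) + 2^N E(K_v) = ℤ·P_v + E(K_v)[2] + 2^N E(K_v)` and (PI) VERBATIM; THIS FILE holds its inputs:
* §1 pure algebra: `mem_sup_range_of_isCoprime_smul_mem` (a scalar prime to `n` cancels modulo `S + nG`),
  `two_nsmul_eq_zero_of_two_pow_nsmul_eq_zero` / `map_mem_torsionBy_sup_range_of_isOfFinAddOrder` (if `A` has no element of order `4`, every
  torsion element maps into `G[2] + 2^N G`), and THE COMBINATION `range_sup_range_eq_of_inputs`: from (1) `7·y ∈ ℤP_K + ℤP₁ + tors` for all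
  `y ∈ A`, (2) no element of order `4` in `A`, (3) the discrepancy `f P₁ ∈ ℤ·f P_K + G[2] + 2^N G`, (4) `G[2] ⊆ f(A)`:
  `f(A) + 2^N G = ℤ·f P_K + G[2] + 2^N G`.
* §2 the frame inputs: the bridge `map_baseChange_congrEquiv_eq_pointsMap` / `pointHom_baseChange_congrEquiv_eq` (`f (P_K)_E = (πP_K)_E` for
  -w3 g10's descended isogeny `f`, via `Isogeny.localPointsMap_pointsMap` and Mathlib's `Affine.Point.map_baseChange`);
  `two_nsmul_eq_zero_of_four_nsmul_eq_zero_of_frame` — NO `K`-RATIONAL POINT OF ORDER 4 on a member: a `Γ_K`-fixed `x ∈ E[2^∞]` splits as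
  `e x + (x − e x)` along the CM projector (-w7 g2 `exists_eigenProjector_two`); `e x ∈ W*^{D_v}` has order `≤ 2` (-w2 g9
  `natCard_fixedPoints_decomp_v_eq_two_of_frame`) and `x − e x ∈ W*′^{D_{v̄}}` likewise (pinning clause at `v̄` for `1 − r`:
  `endEigenPrimaryTorsion_two_pinningClause_swap`); `natCard_torsionBy_two_eq_four_of_cmEndo` (`#E(K)[2] = 4`: `E[2] = W*[2] ⊕ W*′[2]` is
  `Γ_K`-fixed, -w2 `CMPrimes.smul_eq_self_of_two_nsmul_eq_zero`, Galois descent `exists_toGeomPoints_eq_of_forall_smul_eq`, `card_geomTorsion_two_pow`),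
  `finite_and_natCard_torsionBy_two_le_four` (`#((W_K) ⊗ E)(E)[2] ≤ #(W_K)(Ē)[2] = 4`, `card_torsionPoints_eq_sq_holds`), and
  `torsionBy_two_le_range_and_natCard_eq_four_of_cmEndo` (`E(K)[2] → ((W_K) ⊗ E)(E)[2]` is a bijection).

References: [Rubin1999] §2–§3 (Lemma 3.6 (ii)); [Agboola2007] §6 Props. 6.10–6.11; [SilvermanAEC2009] Cor. III.6.4, Prop. VII.6.3, VIII §1.
-/

noncomputable section

open scoped Classical

set_option linter.dupNamespace false
set_option autoImplicit false

open NumberField IsDedekindDomain Field WeierstrassCurve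
open Literature.NumberTheory.EllipticCurves Literature.NumberTheory.EllipticCurves.GreenbergSelmer
open Literature.NumberTheory.EllipticCurves.Agboola2007
open Literature.NumberTheory.GaloisRepresentations

namespace Summit.BirchSwinnertonDyer.BirchSwinnertonDyer.Theorems.PrintCf2.LocalPointImage

open Summit.BirchSwinnertonDyer.BirchSwinnertonDyer.Theorems.PrintCf2.RestrictedSelmerPair
open Summit.BirchSwinnertonDyer.BirchSwinnertonDyer.Theorems.PrintCf2.AdditiveAtSeven
open Summit.BirchSwinnertonDyer.BirchSwinnertonDyer.Theorems.PrintCf2.CMPrimes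

/-! ## §1. Pure algebra -/

section Algebra

variable {A G : Type*} [AddCommGroup A] [AddCommGroup G]

/-- `x ∈ G[2] ↔ 2 • x = 0` (Mathlib's `AddSubgroup.torsionBy G 2`, `ℕ`-scalar form). [folklore] -/
theorem mem_torsionBy_two_iff (x : G) : x ∈ AddSubgroup.torsionBy G 2 ↔ 2 • x = 0 := by
  change x ∈ Submodule.torsionBy ℤ G 2 ↔ _
  rw [Submodule.mem_torsionBy_iff, two_zsmul, two_nsmul]

/-- Every element of `G[2]` is `2`-power torsion (exponent `1`) — the shape of -w2 g11's `C_t` hypothesis. [folklore] -/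
theorem exists_two_pow_nsmul_eq_zero_of_mem_torsionBy_two (c : G) (hc : c ∈ AddSubgroup.torsionBy G 2) : ∃ k : ℕ, 2 ^ k • c = 0 :=
  ⟨1, by rw [pow_one]; exact (mem_torsionBy_two_iff c).mp hc⟩

/-- **Cancelling a scalar prime to `n` modulo `S + nG`**: if `m • y ∈ S ⊔ nG` with `m`, `n` coprime then `y ∈ S ⊔ nG` (Bézout:
`y = a(m y) + n(b y)`). [folklore] -/
theorem mem_sup_range_of_isCoprime_smul_mem (S : AddSubgroup G) {m n : ℤ} (hmn : IsCoprime m n)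
    {y : G} (h : m • y ∈ S ⊔ (zsmulAddGroupHom n : G →+ G).range) :
    y ∈ S ⊔ (zsmulAddGroupHom n : G →+ G).range := by
  obtain ⟨a, b, hab⟩ := hmn
  obtain ⟨s, hs, t, ht, hst⟩ := AddSubgroup.mem_sup.mp h
  obtain ⟨g, rfl⟩ := ht
  have hst' : s + n • g = m • y := by simpa only [zsmulAddGroupHom_apply] using hst
  refine AddSubgroup.mem_sup.mpr ⟨a • s, S.zsmul_mem hs a, n • (a • g + b • y), ⟨a • g + b • y, rfl⟩, ?_⟩
  calc a • s + n • (a • g + b • y) = a • (s + n • g) + (b * n) • y := by module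
    _ = y := by rw [hst', ← mul_zsmul, ← add_zsmul, hab, one_zsmul]

/-- **No element of order `4` ⟹ the `2`-primary torsion is killed by `2`**: if `4 • x = 0 → 2 • x = 0` for all `x ∈ A`, then
`2^(a+1) • x = 0 → 2 • x = 0`. [folklore] -/
theorem two_nsmul_eq_zero_of_two_pow_nsmul_eq_zero (h4 : ∀ x : A, 4 • x = 0 → 2 • x = 0) :
    ∀ (a : ℕ) (x : A), 2 ^ (a + 1) • x = 0 → 2 • x = 0 := by
  intro a
  induction a with
  | zero => intro x hx; simpa using hx
  | succ a ih =>
    intro x hx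
    apply ih
    rw [show 2 ^ (a + 1 + 1) = 4 * 2 ^ a by ring, ← smul_smul] at hx
    have h2 := h4 _ hx
    rw [smul_smul, show 2 * 2 ^ a = 2 ^ (a + 1) by ring] at h2
    exact h2

/-- **Torsion elements map into `G[2] + 2^N G`** when the source has no element of order `4`: write the order as `2^a m` with `m` odd;
`m • T` is `2`-torsion and `m` is prime to `2^N`. [folklore] -/
theorem map_mem_torsionBy_sup_range_of_isOfFinAddOrder (f : A →+ G)
    (h4 : ∀ x : A, 4 • x = 0 → 2 • x = 0) {T : A} (hT : IsOfFinAddOrder T) (N : ℕ) :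
    f T ∈ AddSubgroup.torsionBy G 2 ⊔ (zsmulAddGroupHom ((2 ^ N : ℕ) : ℤ) : G →+ G).range := by
  obtain ⟨n, hn, hnT⟩ := (isOfFinAddOrder_iff_nsmul_eq_zero).mp hT
  obtain ⟨a, m, hm, rfl⟩ := Nat.exists_eq_two_pow_mul_odd hn.ne'
  have h2m : 2 • (m • T) = 0 := by
    refine two_nsmul_eq_zero_of_two_pow_nsmul_eq_zero h4 a (m • T) ?_
    rw [smul_smul, show 2 ^ (a + 1) * m = 2 * (2 ^ a * m) by ring, ← smul_smul, hnT, smul_zero]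
  have hcop : IsCoprime (m : ℤ) ((2 ^ N : ℕ) : ℤ) :=
    Nat.isCoprime_iff_coprime.mpr (hm.coprime_two_right.pow_right N)
  obtain ⟨u, w, huw⟩ := hcop
  have key : T = u • ((m : ℤ) • T) + ((2 ^ N : ℕ) : ℤ) • (w • T) := by
    rw [← mul_zsmul, ← mul_zsmul, mul_comm ((2 ^ N : ℕ) : ℤ) w, ← add_zsmul, huw, one_zsmul]
  rw [key, map_add, map_zsmul, map_zsmul (f) (((2 ^ N : ℕ) : ℤ))]
  refine AddSubgroup.mem_sup.mpr ⟨_, ?_, _, ⟨f (w • T), rfl⟩, rfl⟩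
  rw [mem_torsionBy_two_iff, smul_comm, natCast_zsmul, ← map_nsmul, h2m, map_zero, smul_zero]

/-- **THE COMBINATION (pure algebra).** `f : A → G` additive, `P_K, P₁ ∈ A`, `N : ℕ`. If (1) `7 • y ∈ ℤP_K + ℤP₁ + A_tors` for every `y`,
(2) `A` has no element of order `4`, (3) `f P₁ = c • f P_K + 2^N • R + s` with `2 • s = 0`, (4) `G[2] ⊆ f(A)`, then
`f(A) + 2^N G = (ℤ·f P_K + G[2]) + 2^N G` (`7` is prime to `2^N`). [cite: Rubin1999, §2–§3] [cite: Agboola2007, §6 Props. 6.10–6.11] -/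
theorem range_sup_range_eq_of_inputs (f : A →+ G) (PK P₁ : A) (N : ℕ)
    (hseven : ∀ y : A, ∃ (a b : ℤ) (T : A), IsOfFinAddOrder T ∧ (7 : ℤ) • y = a • PK + b • P₁ + T)
    (h4 : ∀ x : A, 4 • x = 0 → 2 • x = 0)
    (hdisc : ∃ (c : ℤ) (R s : G), f P₁ = c • f PK + ((2 ^ N : ℕ) : ℤ) • R + s ∧ 2 • s = 0)
    (hG2 : AddSubgroup.torsionBy G 2 ≤ f.range) :
    f.range ⊔ (zsmulAddGroupHom ((2 ^ N : ℕ) : ℤ) : G →+ G).range =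
      (AddSubgroup.zmultiples (f PK) ⊔ AddSubgroup.torsionBy G 2) ⊔
        (zsmulAddGroupHom ((2 ^ N : ℕ) : ℤ) : G →+ G).range := by
  apply le_antisymm
  · refine sup_le ?_ le_sup_right
    rintro _ ⟨y, rfl⟩
    obtain ⟨a, b, T, hT, hy⟩ := hseven y
    obtain ⟨c, R, s, hP₁, hs⟩ := hdisc
    have h7 : (7 : ℤ) • f y ∈ (AddSubgroup.zmultiples (f PK) ⊔ AddSubgroup.torsionBy G 2) ⊔
        (zsmulAddGroupHom ((2 ^ N : ℕ) : ℤ) : G →+ G).range := by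
      rw [← map_zsmul, hy, map_add, map_add, map_zsmul, map_zsmul, hP₁]
      refine add_mem (add_mem ?_ ?_) ?_
      · exact AddSubgroup.mem_sup_left (AddSubgroup.mem_sup_left
          (AddSubgroup.zsmul_mem _ (AddSubgroup.mem_zmultiples _) a))
      · rw [smul_add, smul_add]
        refine add_mem (add_mem ?_ ?_) ?_
        · rw [smul_smul]
          exact AddSubgroup.mem_sup_left (AddSubgroup.mem_sup_left
            (AddSubgroup.zsmul_mem _ (AddSubgroup.mem_zmultiples _) _))
        · rw [smul_comm]
          exact AddSubgroup.mem_sup_right ⟨b • R, rfl⟩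
        · refine AddSubgroup.mem_sup_left (AddSubgroup.mem_sup_right ?_)
          rw [mem_torsionBy_two_iff, smul_comm, hs, smul_zero]
      · exact (sup_le_sup_right (le_sup_right : AddSubgroup.torsionBy G 2 ≤ AddSubgroup.zmultiples (f PK) ⊔ _) _)
          (map_mem_torsionBy_sup_range_of_isOfFinAddOrder f h4 hT N)
    have h72 : IsCoprime (7 : ℤ) ((2 ^ N : ℕ) : ℤ) :=
      Nat.isCoprime_iff_coprime.mpr ((by decide : Nat.Coprime 7 2).pow_right N)
    exact mem_sup_range_of_isCoprime_smul_mem _ h72 h7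
  · refine sup_le (sup_le ?_ (hG2.trans le_sup_left)) le_sup_right
    exact (AddSubgroup.zmultiples_le_of_mem (AddSubgroup.mem_sup_left ⟨PK, rfl⟩))

end Algebra

/-! ## §2. The frame inputs -/

section Frame

variable {K : Type} [Field K] [NumberField K]

/-- **Reading a `K`-point in `K̄_E` two ways**: for `W/ℚ`, a `K`-field `E` and `Q ∈ E(K) = (W_K)(K)`, the point `Q` base-changed to
`((W_K) ⊗ E)(E)` (through -w2 g11's `congrEquiv h₁`) and then embedded into `(W_K)(Ē)` by `ψ = Affine.Point.map (K → E → Ē)` equals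
`pointsMap (toGeomPoints Q)` (`K → K̄ → Ē`): both are the base change of `Q` along the unique `K`-algebra map `K → Ē`
(Mathlib `Affine.Point.map_baseChange`). [cite: SilvermanAEC2009, VIII §1] -/
theorem map_baseChange_congrEquiv_eq_pointsMap (W : WeierstrassCurve ℚ) (E : Type) [Field E] [Algebra K E]
    (h₁ : W.baseChange K = (W.baseChange K).baseChange K) (Q : (W.baseChange K).toAffine.Point) :
    Affine.Point.map (W' := W.baseChange K) (IsScalarTower.toAlgHom K E (AlgebraicClosure E))
        (Affine.Point.baseChange (W' := W.baseChange K) K E (Affine.Point.congrEquiv h₁ Q)) =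
      pointsMap (W.baseChange K) E (toGeomPoints (W.baseChange K) Q) := by
  rw [Affine.Point.map_baseChange]
  change _ = Affine.Point.map (W' := W.baseChange K) (closureEmb (K := K) E)
    (Affine.Point.baseChange (W' := W.baseChange K) K (AlgebraicClosure K) Q)
  rw [Affine.Point.map_baseChange]
  rcases Q with _ | ⟨x, y, h⟩
  · exact congrArg (Affine.Point.baseChange (W' := W.baseChange K) K (AlgebraicClosure E)) (Affine.Point.congrEquiv_zero h₁)
  · rw [Affine.Point.congrEquiv_some]; rfl

/-- **The descended CM endomorphism commutes with reading points in `K_v`.** For the isogeny `φ` realising `π` on `E(K̄)`, ANY additive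
`f : E(E) → E(E)` with `ψ ∘ f = φ_E ∘ ψ` (-w3 g10's `exists_pointHom_localPointsMap`) and `P₁ ∈ E(K)` with `P₁ = π P_K` in `E(K̄)`
(-w6 g3's `seven_smul_mem_of_frame`): `f ((P_K)_E) = (P₁)_E`. [cite: SilvermanAEC2009, III §4, VIII §1] -/
theorem pointHom_baseChange_congrEquiv_eq (W : WeierstrassCurve ℚ) (E : Type) [Field E] [Algebra K E]
    (h₁ : W.baseChange K = (W.baseChange K).baseChange K)
    (π : (W.baseChange K).endRing) (φ : Isogeny (W.baseChange K) (W.baseChange K))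
    (hφ : ∀ Q, φ Q = (π : AddMonoid.End (W.baseChange K).geomPoints) Q)
    (f : ((W.baseChange K).baseChange E).toAffine.Point →+ ((W.baseChange K).baseChange E).toAffine.Point)
    (hf : ∀ Q, Affine.Point.map (W' := W.baseChange K) (IsScalarTower.toAlgHom K E (AlgebraicClosure E)) (f Q) =
      φ.localPointsMap E (Affine.Point.map (W' := W.baseChange K) (IsScalarTower.toAlgHom K E (AlgebraicClosure E)) Q))
    {Q P₁ : (W.baseChange K).toAffine.Point}
    (hP₁ : toGeomPoints (W.baseChange K) P₁ =
      (π : AddMonoid.End (W.baseChange K).geomPoints) (toGeomPoints (W.baseChange K) Q)) :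
    f (Affine.Point.baseChange (W' := W.baseChange K) K E (Affine.Point.congrEquiv h₁ Q)) =
      Affine.Point.baseChange (W' := W.baseChange K) K E (Affine.Point.congrEquiv h₁ P₁) := by
  apply Affine.Point.map_injective (W' := W.baseChange K) (IsScalarTower.toAlgHom K E (AlgebraicClosure E))
  rw [hf, map_baseChange_congrEquiv_eq_pointsMap, map_baseChange_congrEquiv_eq_pointsMap, Isogeny.localPointsMap_pointsMap, hφ, hP₁]

/-- **NO `K`-RATIONAL POINT OF ORDER `4` ON A MEMBER** (S3c frame: `C • W = cm7^{(d)}`, `d ≠ 0` squarefree, `d ≢ 1 (4)`, `K` imaginary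
quadratic, `2 = v·v̄`, `π² = π − 2`, `r² = r − 2`, pinning clause at `v`): `4 • Q = 0 → 2 • Q = 0` on `E(K)`. In `E(K̄)`, `Q` is a `Γ_K`-fixed
point of `E[2^∞]`; its CM components `e Q ∈ W*` and `Q − e Q ∈ W*′` (-w7 g2 `exists_eigenProjector_two`, equivariant) are fixed by `D_v`, `D_{v̄}`
respectively, and `#W*^{D_v} = #W*′^{D_{v̄}} = 2` (-w2 g9 `natCard_fixedPoints_decomp_v_eq_two_of_frame`, at `(v, r)` and — via
`endEigenPrimaryTorsion_two_pinningClause_swap` — at `(v̄, 1 − r)`). [cite: Rubin1999, §3 Lemma 3.6 (ii)] [cite: Agboola2007, §6 Prop. 6.11] -/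
theorem two_nsmul_eq_zero_of_four_nsmul_eq_zero_of_frame {d : ℤ} (hd0 : d ≠ 0) (hsq : Squarefree d) (hd4 : d % 4 ≠ 1)
    (W : WeierstrassCurve ℚ) [W.IsElliptic] (C : VariableChange ℚ) (hC : C • W = cm7.quadraticTwist (d : ℚ)) (hK : IsImaginaryQuadratic K)
    (v vbar : HeightOneSpectrum (𝓞 K)) (hv : ((2 : ℕ) : 𝓞 K) ∈ v.asIdeal) (hvbar : ((2 : ℕ) : 𝓞 K) ∈ vbar.asIdeal) (hne : vbar ≠ v)
    (π : (W.baseChange K).endRing) (hrel : (π : AddMonoid.End (W.baseChange K).geomPoints) * π = π - 2) {r : ℤ_[2]} (hr : r * r = r - 2)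
    (hpin : ∀ τ ∈ GreenbergSelmer.inertia v, ∀ x : ↥((W.baseChange K).endEigenPrimaryTorsion 2 π r), τ • x = x ∨ τ • x = -x)
    (Q : (W.baseChange K).toAffine.Point) (h4 : 4 • Q = 0) : 2 • Q = 0 := by
  haveI : Fact (Nat.Prime 2) := ⟨Nat.prime_two⟩
  have hj : W.j = -3375 := j_eq_of_smul_eq_cm7Twist hd0 W C hC
  obtain ⟨θ, hθ⟩ := exists_sq_eq_neg_seven_of_cmEndo_mem_endRing W K hj π hrel
  have hr' : (1 - r) * (1 - r) = (1 - r) - 2 := by linear_combination hr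
  obtain ⟨e, -, -, hesub, he⟩ := exists_eigenProjector_two W hj K hθ π hrel hr
  -- the two fixed-point counts
  have hcard := natCard_fixedPoints_decomp_v_eq_two_of_frame hd0 hsq hd4 W C hC hK v vbar hv hvbar hne π hrel hr hpin
  obtain ⟨hpin', -⟩ := endEigenPrimaryTorsion_two_pinningClause_swap W K hj hK hθ π hrel hr hv hvbar hne hpin
  have hcard' := natCard_fixedPoints_decomp_v_eq_two_of_frame hd0 hsq hd4 W C hC hK vbar v hvbar hv hne.symm π hrel hr' hpin'
  -- `Q` in `E[2^∞]`, `Γ_K`-fixed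
  set x := toGeomPoints (W.baseChange K) Q with hx
  have hx4 : 2 ^ 2 • x = 0 := by rw [hx, show (2 : ℕ) ^ 2 = 4 by norm_num, ← map_nsmul, h4, map_zero]
  have hxmem : x ∈ (W.baseChange K).geomPrimaryTorsion 2 :=
    (AddCommGroup.mem_primaryComponent).mpr ⟨2, hx4⟩
  set xp : (W.baseChange K).geomPrimaryTorsion 2 := ⟨x, hxmem⟩ with hxp
  have hfix : ∀ σ : absoluteGaloisGroup K, σ • xp = xp := fun σ ↦
    Subtype.ext (by rw [hxp, primaryComponent.coe_smul]; exact smul_toGeomPoints (W.baseChange K) σ Q)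
  -- an element of a group of order `2` is killed by `2`
  have key : ∀ {ρ : ℤ_[2]} (w : HeightOneSpectrum (𝓞 K)),
      Nat.card (FixedPoints.addSubgroup (GreenbergSelmer.decomp w) ↥((W.baseChange K).endEigenPrimaryTorsion 2 π ρ)) = 2 →
      ∀ z : ↥((W.baseChange K).endEigenPrimaryTorsion 2 π ρ), (∀ σ : absoluteGaloisGroup K, σ • z = z) → 2 • z = 0 := by
    intro ρ w hw z hz
    haveI : Finite (FixedPoints.addSubgroup (GreenbergSelmer.decomp w) ↥((W.baseChange K).endEigenPrimaryTorsion 2 π ρ)) :=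
      Nat.finite_of_card_ne_zero (by rw [hw]; norm_num)
    have hzmem : z ∈ FixedPoints.addSubgroup (GreenbergSelmer.decomp w) ↥((W.baseChange K).endEigenPrimaryTorsion 2 π ρ) := by
      rw [FixedPoints.mem_addSubgroup]
      exact fun g ↦ hz g
    have hdvd := addOrderOf_dvd_natCard (⟨z, hzmem⟩ : FixedPoints.addSubgroup (GreenbergSelmer.decomp w)
      ↥((W.baseChange K).endEigenPrimaryTorsion 2 π ρ))
    rw [hw] at hdvd
    have h2 : 2 • (⟨z, hzmem⟩ : FixedPoints.addSubgroup (GreenbergSelmer.decomp w)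
      ↥((W.baseChange K).endEigenPrimaryTorsion 2 π ρ)) = 0 := addOrderOf_dvd_iff_nsmul_eq_zero.mp hdvd
    exact congrArg Subtype.val h2
  -- the `W*`-component
  have h₁ : 2 • (e xp : (W.baseChange K).geomPrimaryTorsion 2) = 0 := by
    have h := key v hcard (e xp) fun σ ↦ by rw [← he, hfix]
    rw [← AddSubgroupClass.coe_nsmul, h]; rfl
  -- the `W*′`-component
  have h₂ : 2 • (xp - (e xp : (W.baseChange K).geomPrimaryTorsion 2)) = 0 := by
    have h := key vbar hcard' ⟨xp - e xp, hesub xp⟩ fun σ ↦ Subtype.ext (by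
      rw [endEigenPrimaryTorsion.coe_smul, smul_sub, hfix, ← endEigenPrimaryTorsion.coe_smul, ← he, hfix])
    exact congrArg Subtype.val h
  have h2x : 2 • xp = 0 := by
    have : xp = (e xp : (W.baseChange K).geomPrimaryTorsion 2) + (xp - e xp) := by abel
    rw [this, smul_add, h₁, h₂, add_zero]
  have h2x' : 2 • x = 0 := by
    have := congrArg Subtype.val h2x
    simpa [hxp] using this
  apply toGeomPoints_injective (W.baseChange K)
  rw [map_nsmul, ← hx, h2x', map_zero]

/-- **`E[2] ⊆ E(K)` and `#E(K)[2] = 4` on a member** (`W/ℚ` with `j = −3375`, `K` a number field with `θ² = −7`, `π ∈ End_K(E_K)`, `π² = π − 2`,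
`r² = r − 2`): `E[2] = W*[2] ⊕ W*′[2]` and each summand's `2`-torsion is fixed by all of `Γ_K` (-w2 `CMPrimes.smul_eq_self_of_two_nsmul_eq_zero`),
so `toGeomPoints` is a bijection `E(K)[2] → E[2]` (Galois descent `exists_toGeomPoints_eq_of_forall_smul_eq`), and `#E[2] = 4`
(`card_geomTorsion_two_pow`). [cite: Rubin1999, §2 and Prop. 5.4] [cite: SilvermanAEC2009, Cor. III.6.4, VIII §1] -/
theorem natCard_torsionBy_two_eq_four_of_cmEndo (W : WeierstrassCurve ℚ) [W.IsElliptic] (hj : W.j = -3375) {θ : K} (hθ : θ ^ 2 = -7)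
    (π : (W.baseChange K).endRing) (hrel : (π : AddMonoid.End (W.baseChange K).geomPoints) * π = π - 2) {r : ℤ_[2]} (hr : r * r = r - 2) :
    Nat.card (AddSubgroup.torsionBy (W.baseChange K).toAffine.Point 2) = 4 := by
  haveI : Fact (Nat.Prime 2) := ⟨Nat.prime_two⟩
  haveI : (W.baseChange K).IsElliptic := by rw [baseChange]; infer_instance
  have hr' : (1 - r) * (1 - r) = (1 - r) - 2 := by linear_combination hr
  obtain ⟨e, -, -, hesub, -⟩ := exists_eigenProjector_two W hj K hθ π hrel hr
  -- `E(K)[2] → E[2]`, `Q ↦ toGeomPoints Q`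
  have h4 : Nat.card (geomTorsion (W.baseChange K) (2 : ℤ)) = 4 := by
    have h := card_geomTorsion_two_pow (W.baseChange K) two_ne_zero 1
    simpa using h
  let t : AddSubgroup.torsionBy (W.baseChange K).toAffine.Point 2 → geomTorsion (W.baseChange K) (2 : ℤ) :=
    fun Q ↦ ⟨toGeomPoints (W.baseChange K) Q, by
      have hQ := (mem_torsionBy_two_iff (Q : (W.baseChange K).toAffine.Point)).mp Q.2
      change toGeomPoints (W.baseChange K) Q ∈ AddSubgroup.torsionBy _ 2
      rw [mem_torsionBy_two_iff, ← map_nsmul, hQ, map_zero]⟩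
  have htinj : Function.Injective t := fun a b hab ↦
    Subtype.ext (toGeomPoints_injective (W.baseChange K) (congrArg Subtype.val hab))
  have htsurj : Function.Surjective t := by
    rintro ⟨z, hz⟩
    have hz2 : 2 • z = 0 := (mem_torsionBy_two_iff z).mp hz
    have hzmem : z ∈ (W.baseChange K).geomPrimaryTorsion 2 := (AddCommGroup.mem_primaryComponent).mpr ⟨1, by rw [pow_one, hz2]⟩
    set zp : (W.baseChange K).geomPrimaryTorsion 2 := ⟨z, hzmem⟩ with hzp
    have hzp2 : 2 • zp = 0 := Subtype.ext (by rw [AddSubgroupClass.coe_nsmul]; exact hz2)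
    -- both CM components are `2`-torsion, hence `Γ_K`-fixed
    have he2 : 2 • (e zp : (W.baseChange K).geomPrimaryTorsion 2) = 0 := by
      rw [← AddSubgroupClass.coe_nsmul, ← map_nsmul, hzp2, map_zero]; rfl
    have he2' : 2 • (zp - (e zp : (W.baseChange K).geomPrimaryTorsion 2)) = 0 := by
      rw [smul_sub, hzp2, he2, sub_zero]
    have hfix : ∀ σ : absoluteGaloisGroup K, σ • zp = zp := fun σ ↦ by
      have h1 := CMPrimes.smul_eq_self_of_two_nsmul_eq_zero W K hj hθ π hrel hr σ _ (e zp).2 he2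
      have h2 := CMPrimes.smul_eq_self_of_two_nsmul_eq_zero W K hj hθ π hrel hr' σ _ (hesub zp) he2'
      have : zp = (e zp : (W.baseChange K).geomPrimaryTorsion 2) + (zp - e zp) := by abel
      rw [this, smul_add, h1, h2]
    have hfixz : ∀ σ : absoluteGaloisGroup K, σ • z = z := fun σ ↦ by
      have := congrArg Subtype.val (hfix σ)
      simpa [hzp] using this
    obtain ⟨Q, hQ⟩ := exists_toGeomPoints_eq_of_forall_smul_eq (W.baseChange K) hfixz
    have hQ2 : 2 • Q = 0 := by
      apply toGeomPoints_injective (W.baseChange K)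
      rw [map_nsmul, hQ, hz2, map_zero]
    exact ⟨⟨Q, (mem_torsionBy_two_iff Q).mpr hQ2⟩, Subtype.ext hQ⟩
  rw [← h4]
  exact Nat.card_congr (Equiv.ofBijective t ⟨htinj, htsurj⟩)

/-- **`#((W_K) ⊗ E)(E)[2] ≤ 4`** for every `K`-field `E`: `ψ : ((W_K) ⊗ E)(E) ↪ (W_K)(Ē)` and `#(W_K)(Ē)[2] = 4` (`card_torsionPoints_eq_sq_holds`).
Also the `2`-torsion is finite. [cite: SilvermanAEC2009, Cor. III.6.4] -/
theorem finite_and_natCard_torsionBy_two_le_four (W : WeierstrassCurve ℚ) [W.IsElliptic] (E : Type) [Field E] [Algebra K E] :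
    Finite (AddSubgroup.torsionBy ((W.baseChange K).baseChange E).toAffine.Point 2) ∧
      Nat.card (AddSubgroup.torsionBy ((W.baseChange K).baseChange E).toAffine.Point 2) ≤ 4 := by
  haveI : (W.baseChange K).IsElliptic := by rw [baseChange]; infer_instance
  haveI : CharZero E := charZero_of_injective_algebraMap (algebraMap K E).injective
  have h2 : ((2 : ℕ) : AlgebraicClosure E) ≠ 0 := by
    haveI : CharZero (AlgebraicClosure E) := charZero_of_injective_algebraMap (algebraMap E (AlgebraicClosure E)).injective
    exact_mod_cast (two_ne_zero : (2 : AlgebraicClosure E) ≠ 0)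
  have hcard : Nat.card (torsionPoints (W.baseChange K) (AlgebraicClosure E) (2 : ℕ)) = 4 := by
    rw [card_torsionPoints_eq_sq_holds (W.baseChange K) (AlgebraicClosure E) h2]; norm_num
  haveI : Finite (torsionPoints (W.baseChange K) (AlgebraicClosure E) (2 : ℕ)) := Nat.finite_of_card_ne_zero (by rw [hcard]; norm_num)
  set ψ : ((W.baseChange K).baseChange E).toAffine.Point →+ localPoints (W.baseChange K) E :=
    Affine.Point.map (W' := W.baseChange K) (IsScalarTower.toAlgHom K E (AlgebraicClosure E)) with hψ
  have hψinj : Function.Injective ψ := Affine.Point.map_injective (W' := W.baseChange K) (IsScalarTower.toAlgHom K E (AlgebraicClosure E))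
  let g : AddSubgroup.torsionBy ((W.baseChange K).baseChange E).toAffine.Point 2 → torsionPoints (W.baseChange K) (AlgebraicClosure E) (2 : ℕ) :=
    fun s ↦ ⟨ψ s, by
      have hs := (mem_torsionBy_two_iff (s : ((W.baseChange K).baseChange E).toAffine.Point)).mp s.2
      change ψ s ∈ AddSubgroup.torsionBy _ ((2 : ℕ) : ℤ)
      rw [Nat.cast_ofNat, mem_torsionBy_two_iff]
      exact ((map_nsmul ψ 2 (s : ((W.baseChange K).baseChange E).toAffine.Point)).symm.trans (by rw [hs, map_zero]) : _)⟩
  have hg : Function.Injective g := fun a b hab ↦ Subtype.ext (hψinj (congrArg Subtype.val hab))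
  exact ⟨Finite.of_injective g hg, hcard ▸ Nat.card_le_card_of_injective g hg⟩

/-- **`E(K)[2] → ((W_K) ⊗ E)(E)[2]` IS A BIJECTION on a member** (`j = −3375`, `θ² = −7`, `π`, `r` as above; `E` any `K`-field): the `2`-torsion of
`((W_K) ⊗ E)(E)` lies in the image of `E(K)` — `G[2] ≤ range (Affine.Point.baseChange K E)` — and has EXACTLY `4` elements.
[cite: SilvermanAEC2009, Cor. III.6.4, VIII §1] [cite: Rubin1999, §2] -/
theorem torsionBy_two_le_range_and_natCard_eq_four_of_cmEndo (W : WeierstrassCurve ℚ) [W.IsElliptic] (hj : W.j = -3375) {θ : K}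
    (hθ : θ ^ 2 = -7) (π : (W.baseChange K).endRing) (hrel : (π : AddMonoid.End (W.baseChange K).geomPoints) * π = π - 2)
    {r : ℤ_[2]} (hr : r * r = r - 2) (E : Type) [Field E] [Algebra K E] (h₁ : W.baseChange K = (W.baseChange K).baseChange K) :
    AddSubgroup.torsionBy ((W.baseChange K).baseChange E).toAffine.Point 2 ≤ (Affine.Point.baseChange (W' := W.baseChange K) K E).range ∧
      Nat.card (AddSubgroup.torsionBy ((W.baseChange K).baseChange E).toAffine.Point 2) = 4 := by
  obtain ⟨hfin, hle⟩ := finite_and_natCard_torsionBy_two_le_four (K := K) W E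
  haveI := hfin
  have h4 := natCard_torsionBy_two_eq_four_of_cmEndo W hj hθ π hrel hr
  set bc := Affine.Point.baseChange (W' := W.baseChange K) K E with hbc
  have hbcinj : Function.Injective bc := Affine.Point.map_injective (W' := W.baseChange K) (Algebra.ofId K E)
  let g : AddSubgroup.torsionBy (W.baseChange K).toAffine.Point 2 → AddSubgroup.torsionBy ((W.baseChange K).baseChange E).toAffine.Point 2 :=
    fun Q ↦ ⟨bc (Affine.Point.congrEquiv h₁ Q), by
      have hQ := (mem_torsionBy_two_iff (Q : (W.baseChange K).toAffine.Point)).mp Q.2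
      rw [mem_torsionBy_two_iff, ← map_nsmul, ← map_nsmul, hQ, map_zero, map_zero]⟩
  have hg : Function.Injective g := fun a b hab ↦
    Subtype.ext ((Affine.Point.congrEquiv h₁).injective (hbcinj (congrArg Subtype.val hab)))
  have hbij : Function.Bijective g := hg.bijective_of_nat_card_le (by rw [h4]; exact hle)
  refine ⟨fun s hs ↦ ?_, ?_⟩
  · obtain ⟨Q, hQ⟩ := hbij.2 ⟨s, hs⟩
    exact ⟨Affine.Point.congrEquiv h₁ Q, congrArg Subtype.val hQ⟩
  · rw [← h4]
    exact (Nat.card_congr (Equiv.ofBijective g hbij)).symm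

end Frame

end Summit.BirchSwinnertonDyer.BirchSwinnertonDyer.Theorems.PrintCf2.LocalPointImage

end
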